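import Summits.AtomisticToContinuum.BoseEinsteinCondensation.Theorems.BECThomsonPrincipleGDTransferSeededIvtGlue
import Summits.AtomisticToContinuum.BoseEinsteinCondensation.Theorems.BECThomsonPrincipleGDTransferSeededCountLaw
import Summits.AtomisticToContinuum.BoseEinsteinCondensation.Theorems.BECThomsonPrincipleGDTransferSeededFreeCorner

/-!
# SKELETON of the ALTERNATIVE line `measurable-transport` (strategist s1, 2026-08-17) — crux `GDTransfer`
# (stmt-AtomisticToContinuum-9482), route BECThomsonPrinciple

An alternative to the live skeleton `seeded-continuity` (v4/v5, lead c2) that differs from it at ONE of its two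
stuck stubs, `stub_roughPotentials` (v5: `stub_roughNull` + `stub_essentiallyRough`): the soft class on which the
connectedness assembly runs is widened from FINITE CONTINUOUS profiles to ALL BOUNDED MEASURABLE admissible
profiles (soft spheres / square wells `v = B·𝟙[r ≤ R]` and every other essentially discontinuous bounded profile),
by changing the TRANSPORT DEVICE of local constancy in the side:

* live line (`stub_localConstancy`, landed p138765): dilate the near-minimiser and compare the two interactions
  through the UNIFORM closeness `sup |b⁻²u(·/b) − u| → 0` (`vb_scaledPotential_close`) — this is the only place
  where continuity of the profile is used, and it fails for a step profile (`sup = B` for every `b ≠ 1`);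
* this line (`stub_localConstancyBdd`): compare the two interactions on an ARBITRARY near-minimiser `Φ` by the
  fibrewise Hölder–Sobolev bound `⟨Φ, Σ_{i<j}|w|^per(xᵢ−xⱼ) Φ⟩ ≤ K(N,L) ‖w‖_{L^{3/2}(ℝ³)} (T(Φ) + 1)`
  (Hölder `3/2 · 3`, `‖Φ(·,X̂)‖²_{L⁶(cell)} ≤ C_S(L)(‖∇ᵢΦ(·,X̂)‖²_{L²} + ‖Φ(·,X̂)‖²_{L²})` by the cut-off
  Gagliardo–Nirenberg–Sobolev template of `poincare_sobolev_torus` with `p = 2, p* = 6`, finitely many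
  periodic images) together with the `L^{3/2}`-continuity of dilations `‖b⁻²u(·/b) − u‖_{L^{3/2}(ℝ³)} → 0`
  (`b → 1`) and the a-priori kinetic bound `T(Φ) ≤ E(Φ) ≤ E₀ + δ ≤ N²B`: the transport error is
  `≤ K‖u_b − u‖_{3/2}(N²B + 1) → 0` UNIFORMLY over near-minimisers, with no regularity of `u` at all.
  Law stability at fixed `(N, L)` (`hiMass_toReal_close_of_nearMinimisers`, `lawMass_le_of_nearMinimisers`) is
  already proved for measurable bounded finite-range profiles, so nothing else in `LocalConstancy` changes.

The dichotomy `GD ⇒ BandEmptiness` is re-run for bounded measurable profiles (`stub_bandEmptinessBdd`: the landed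
plain-pair files use `IsFiniteContinuous` only for integrability / Fubini bookkeeping — `continuous_pairWeight`,
`lintegral_ne_top_of_isFiniteContinuous` — which bounded measurability also provides on the compact cell).
Essentially bounded profiles are reduced to pointwise bounded ones by truncation at the essential bound plus the
null-modification invariance `stub_roughNull` (verbatim the lead's v5 stub: a.e.-equal radial lifts have the same
periodic BEC statement).  What is left — ESSENTIALLY UNBOUNDED profiles: hard cores on positive measure (GD's chord is
silent at `⊤` energy, `gdChord_of_energy_top`) and essentially unbounded integrable profiles — is `stub_singularRest`
(crux-sized, implied by the crux).  The SEED `stub_noBalancedCat` is shared verbatim with the live line (same `Sig`).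

`sorry` lives exactly in the five registered stubs; `GDTransfer_of` / `GDTransfer_holds_of_stubs` conclude the crux
BY NAME, sorry-free, over the landed `stub_countLaw` (p138222), `stub_freeCorner` (p138122), `stub_ivtGlue` (p138348).

Card: `Cruxes/GDTransfer/Lines/measurable-transport.md`.  Census: `Cruxes/GDTransfer/STRATEGY-CENSUS.md` (s1).
-/

noncomputable section

open MeasureTheory Filter
open scoped ENNReal NNReal

namespace Summit.AtomisticToContinuum.BoseEinsteinCondensation.Cruxes.GDTransfer.MeasurableTransport

open Literature.MathematicalPhysics.QuantumManyBody.BoseGas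
open Summit.AtomisticToContinuum.BoseEinsteinCondensation.Theses.BECThomsonPrinciple
open Summit.AtomisticToContinuum.BoseEinsteinCondensation.Cruxes.GDTransfer.DysonDressedWitness
  (PeriodicBECFor gdTransfer_iff)
open Summit.AtomisticToContinuum.BoseEinsteinCondensation.Cruxes.GDTransfer.Seeded
  (NoBalancedCat BandEmptiness FreeCorner CountLaw LocalConstancy stub_ivtGlue stub_countLaw stub_freeCorner)

/-! ## §0 Vocabulary -/

/-- Pointwise BOUNDED profile (the hypothesis of `FibreConductance`; with `IsRepulsiveFiniteRange` = measurable, finite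
range, `v ≤ B`: the class on which law stability at fixed `(N, L)` is proved in tree). No continuity. -/
def IsBoundedProfile (v : ℝ → ℝ≥0∞) : Prop :=
  ∃ B : ℝ, ∀ r, v r ≤ ENNReal.ofReal B

/-- ESSENTIALLY bounded profile: the radial lift `x ↦ v ‖x‖` is bounded Lebesgue-a.e. on `ℝ³` (so hard-core values
on a null set of radii are allowed; hard cores on positive measure and essentially unbounded profiles are not). -/
def IsEssBoundedProfile (v : ℝ → ℝ≥0∞) : Prop :=
  ∃ B : ℝ, ∀ᵐ x : Space, v ‖x‖ ≤ ENNReal.ofReal B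

/-! ## §1 Registered stub signatures -/

/-- Registered signature of `stub_bandEmptinessBdd` [M–L; the landed plain-pair dichotomy `gd_bandEmptiness`
(p145164 over p141210 p143854 p142740 p139731 p140462) re-run with `IsFiniteContinuous` replaced by bounded
measurability — continuity enters those files only as integrability/Fubini bookkeeping on the compact cell]. -/
def Sig.stub_bandEmptinessBdd : Prop :=
  GaussianDominationCan → ∀ v : ℝ → ℝ≥0∞, IsRepulsiveFiniteRange v → IsBoundedProfile v → BandEmptiness v

/-- Registered signature of `stub_localConstancyBdd` [L; THE NEW DEVICE: local constancy of the law of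
near-minimisers in the side for bounded measurable profiles — transport error controlled on arbitrary near-minimisers
by fibrewise Hölder–Sobolev (`L^{3/2} × L³`, `H¹(cell) ⊂ L⁶(cell)` per particle, cut-off GNS as in
`poincare_sobolev_torus`) and `L^{3/2}`-continuity of dilations; law stability at fixed `(N,L)` as landed
(`hiMass_toReal_close_of_nearMinimisers`)]. -/
def Sig.stub_localConstancyBdd : Prop :=
  CountLaw → ∀ v : ℝ → ℝ≥0∞, IsRepulsiveFiniteRange v → IsBoundedProfile v → LocalConstancy v

/-- Registered signature of `stub_roughNull` [M; VERBATIM the live line's v5 stub (`SeededRoughDefs`): a.e.-equal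
radial lifts give the same periodic BEC statement — the periodic energy sees the profile only through the a.e. class
of `X ↦ Σ v^per(xᵢ − xⱼ)` (pair maps are shears of Haar measure)]. -/
def Sig.stub_roughNull : Prop :=
  ∀ v w : ℝ → ℝ≥0∞, IsRepulsiveFiniteRange v → IsRepulsiveFiniteRange w →
    (∀ᵐ x : Space, v ‖x‖ = w ‖x‖) → PeriodicBECFor w → PeriodicBECFor v

/-- Registered signature of `stub_singularRest` [crux-sized; the ESSENTIALLY UNBOUNDED regime — hard cores on a set
of positive measure (plain witnesses have `⊤` energy, GD's chord is silent there: `gdChord_of_energy_top`) and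
essentially unbounded integrable profiles — given GD, the seed and periodic BEC for every bounded measurable admissible
profile; Dyson-dressed projected witnesses / inherited GD for `v ∧ n` at fixed `(N,L)` / hard ⇐ soft comparison
(route BECHardSphereComparison); implied by the crux (`singularRest_of_gdTransfer`)]. -/
def Sig.stub_singularRest : Prop :=
  GaussianDominationCan → NoBalancedCat →
    (∀ w : ℝ → ℝ≥0∞, IsRepulsiveFiniteRange w → IsBoundedProfile w → PeriodicBECFor w) →
    ∀ v : ℝ → ℝ≥0∞, IsRepulsiveFiniteRange v → ¬ IsEssBoundedProfile v → PeriodicBECFor v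

/-! ## §2 Registered stubs (sorried) -/

/-- `stub_noBalancedCat` [the SEED; open-problem-sized; SHARED verbatim with the live line (`Seeded.Sig`)]. -/
theorem stub_noBalancedCat : Summit.AtomisticToContinuum.BoseEinsteinCondensation.Cruxes.GDTransfer.Seeded.Sig.stub_noBalancedCat := by
  sorry

/-- `stub_bandEmptinessBdd` [M–L]: GD empties the middle band for bounded measurable profiles. -/
theorem stub_bandEmptinessBdd : Sig.stub_bandEmptinessBdd := by
  sorry

/-- `stub_localConstancyBdd` [L; the new device]: local constancy in the side for bounded measurable profiles. -/
theorem stub_localConstancyBdd : Sig.stub_localConstancyBdd := by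
  sorry

/-- `stub_roughNull` [M; shared with the live line v5]: null-modification invariance of periodic BEC. -/
theorem stub_roughNull : Sig.stub_roughNull := by
  sorry

/-- `stub_singularRest` [crux-sized]: hard cores on positive measure and essentially unbounded profiles. -/
theorem stub_singularRest : Sig.stub_singularRest := by
  sorry

/-! ## §3 Composition (sorry-free): the five statements give the crux BY NAME -/

/-- **The line concludes the crux BY NAME.** Bounded measurable profiles through the connectedness assembly (count law,
seed, band emptiness from GD, free corner, local constancy by the Sobolev transport); essentially bounded profiles by
truncation at the essential bound + null-modification invariance; the essentially unbounded rest through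
`stub_singularRest` fed with that conclusion. -/
theorem GDTransfer_of :
    Summit.AtomisticToContinuum.BoseEinsteinCondensation.Cruxes.GDTransfer.Seeded.Sig.stub_noBalancedCat →
      Sig.stub_bandEmptinessBdd → Sig.stub_localConstancyBdd → Sig.stub_roughNull → Sig.stub_singularRest →
      GDTransfer := by
  intro hSeed hBand hLoc hNull hRest
  rw [gdTransfer_iff]
  intro hG v hv
  have hsoft : ∀ w : ℝ → ℝ≥0∞, IsRepulsiveFiniteRange w → IsBoundedProfile w → PeriodicBECFor w :=
    fun w hw hb => stub_ivtGlue stub_countLaw hSeed w hw (hBand hG w hw hb) (stub_freeCorner w hw)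
      (hLoc stub_countLaw w hw hb)
  by_cases hess : IsEssBoundedProfile v
  · obtain ⟨B, hB⟩ := hess
    let w : ℝ → ℝ≥0∞ := fun r => min (v r) (ENNReal.ofReal B)
    have hw : IsRepulsiveFiniteRange w := by
      refine ⟨hv.1.min measurable_const, ?_⟩
      obtain ⟨R₀, hR₀⟩ := hv.2
      refine ⟨R₀, fun r hr => ?_⟩
      show min (v r) (ENNReal.ofReal B) = 0
      rw [hR₀ r hr]
      exact min_eq_left bot_le
    have hwb : IsBoundedProfile w := ⟨B, fun r => min_le_right _ _⟩
    have hae : ∀ᵐ x : Space, v ‖x‖ = w ‖x‖ :=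
      hB.mono fun x hx => (min_eq_left hx).symm
    exact hNull v w hv hw hae (hsoft w hw hwb)
  · exact hRest hG hSeed hsoft v hv hess

/-- **The crux from the five registered stubs** (sorries live only inside `stub_*`). -/
theorem GDTransfer_holds_of_stubs : GDTransfer :=
  GDTransfer_of stub_noBalancedCat stub_bandEmptinessBdd stub_localConstancyBdd stub_roughNull stub_singularRest

/-! ## §4 Sanity (sorry-free) -/

/-- The rest stub is a weakening of the crux (implied by it) — not a costume of it: it only meets essentially
unbounded profiles and is fed the bounded conclusion. -/
theorem singularRest_of_gdTransfer (h : GDTransfer) : Sig.stub_singularRest :=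
  fun hG _ _ v hv _ => (gdTransfer_iff.mp h) hG v hv

/-- Finite continuous admissible profiles are bounded (so this line's soft class contains the live line's). -/
theorem isBoundedProfile_of_bound {v : ℝ → ℝ≥0∞} {B : ℝ} (h : ∀ r, v r ≤ ENNReal.ofReal B) :
    IsBoundedProfile v := ⟨B, h⟩

/-- Pointwise bounded ⇒ essentially bounded. -/
theorem isEssBoundedProfile_of_isBoundedProfile {v : ℝ → ℝ≥0∞} (h : IsBoundedProfile v) :
    IsEssBoundedProfile v := by
  obtain ⟨B, hB⟩ := h
  exact ⟨B, Filter.Eventually.of_forall fun x => hB ‖x‖⟩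

/-- The soft-sphere / square-well profile `B·𝟙[r ≤ R]` (discontinuous, NOT in the live line's finite-continuous class)
is admissible and bounded, hence inside this line's soft class. -/
theorem softSphere_mem {B R : ℝ} :
    IsRepulsiveFiniteRange (fun r => if r ≤ R then ENNReal.ofReal B else 0) ∧
      IsBoundedProfile (fun r => if r ≤ R then ENNReal.ofReal B else 0) := by
  refine ⟨⟨?_, R, fun r hr => by simp [not_le.mpr hr]⟩, B, fun r => ?_⟩
  · exact Measurable.ite measurableSet_Iic measurable_const measurable_const
  · by_cases h : r ≤ R <;> simp [h]

end Summit.AtomisticToContinuum.BoseEinsteinCondensation.Cruxes.GDTransfer.MeasurableTransport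

end
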